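import Summits.QuantumFields.YangMills.Theorems.BalabanUVNodesN16Thm4TorusOfZd
import HarnessLib

/-!
# Route «BalabanUVNodes», cluster K4 «SpineRates» — node N16 = NE3: THE PERIODICITY PRINCIPLE WITH THE MULTI-SCALE CONCLUSION SLOT (repair R-β″, PRODUCER HALF,
# (R5)): `Thm4TorusAt` at period `0` with print's (1.36)∕(1.38)∕(1.39) list, the (1.36)₃ line read ALONG LATTICE LINES, implies the same at period `N·Lᵏ` —
# twin of generation 0's file 2 §2–§3 (`N16.conclZd_shiftCfg` ∕ `N16.thm4TorusAt_print_of_zd`)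

Cell `pub-ymgap`, seat `pub-ymgap-dag-n16-c` (R134 fan-out seat, strategy s1; HUMAN RULING D-0062; chair R424 venue), generation 4, file 32.
`--supports stmt-QuantumFields-19912 --as helper` (K3‴ `SpineGivenEndpointR13`, route rev 16).  `bears_on: R4∕N16 · edge N05 → N16`.  Located item:
`HOME/pub-ymgap-dag-n16-c/LOCATED-N16-HOLDER-PIN.md`, census row R-β″ (ADDENDUM 5).  Consumer: file 31 `N16HolderMSThm4Print` ((T4ᵀ_print-MS) ⟹ (OUT_print-MS));
producer of the hypothesis (successor, (R6)): the MS twin of g0's `Thm4ZdPrintOfLeaf` ∕ `OfLeaf` over brick 2 `N16HolderMSReadouts`.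

WHY.  Generation 0's periodicity principle `N16.thm4TorusAt_of_period_zero` is stated for an ABSTRACT conclusion slot with a covariance hypothesis; its concrete
instance `conclZd_shiftCfg` proved the covariance of print's list with the (1.36)₃ line at nearest-neighbour distance.  The multi-scale line «`‖Ad (hol U₀ y (seg μ j))
(D^η_{U₀,μ}A_κ)(y+j•e_μ) − D^η_{U₀,μ}A_κ(y)‖ ≤ B_h(α₀+α₁)·ξ^{kβ}·j^β`» is covariant too — for `Lᵏa`-periodic `U₀` the word holonomy satisfies `W(Γ_{y,·}) = W(Γ_{y+v,·})`
(`B12Ineq417Flat.hol_shiftCfg`; brick 2 §3) — so the principle applies verbatim.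

WHAT THIS FILE PROVES (kernel, theorems only, 0 `def`, 0 sorry): §1 `conclZdMS_shiftCfg`; §2 `thm4TorusAt_printMS_of_zd`.
HONEST FRAMING: bookkeeping (translation covariance + g0's abstract principle BY NAME); the `ℤᵈ` reading of [Balaban1985RegularSpaces] Thm 4 + Prop 3 with the
multi-scale line is node N05's theorem, NOT proved; N16 ∕ NE3 NOT discharged; count-neutral; one finite four-torus at fixed ε — NOT ℝ⁴, NOT infinite volume, NOT OS,
NOT a mass gap, NOT Clay.
-/

set_option autoImplicit false

open scoped BigOperators Matrix Matrix.Norms.L2Operator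
open NormedSpace

namespace Summit.QuantumFields.YangMills.BalabanUVNodes.N16HolderMSTorusOfZd

open Literature.MathematicalPhysics.QuantumFieldTheory.Balaban1983to89
open B7Prop1Explicit B7Prop2Explicit
open T4AveragingDeficitWall (Ad)
open B7Eq92Concrete (mgauge)
open B8Ineq132 (covDerivFwd InAk)
open B8Eq184Proof (cfgExp)
open B8Eq119TwistedAxial (Restr129 InAx)
open B8Eq133Hypotheses (Reg335Zd)
open B8Eq138LandauZd (covLap IsLandau138)
open B8Thm4TorusAt (torusLam Cond166T Thm4TorusAt)
open B12Ineq417Flat (shiftCfg shiftCfg_apply shiftCfg_zero hol_shiftCfg)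
open B7TranslationCovariance (mgauge_shiftCfg)
open B8Prop3GaugeFixedKLevel (eq_mgauge_inv_of_mgauge_eq mem_unitaryUnits_of_mgauge_eq logField_spec)
open Complex (I)
open MatrixLog (mlog)
open Summit.QuantumFields.BalabanUV.T4Continuum
open BlockAverageCurrent (curConst)
open NE3EnergyWeightedCovShape (NE3EnergyRateWCov)
open NE3RightInverseSupLetters (frameC)
open NE3.LeafIndexSockets (LeafH3sup)
open MinimalActionRate (sfClass)
open N16.TorusShift (restr129_torusLam_shiftCfg isLandau138_torusLam_shiftCfg covDerivFwd_shiftCfg covLap_shiftCfg cfgExp_shiftCfg)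

noncomputable section

open N16 (thm4TorusAt_of_period_zero periodic_of_mgauge_cfgExp)

variable {d : ℕ}


/-! ## §1 The multi-scale conclusion slot: covariance of its `ℤᵈ` form -/

section Concrete

variable {n : Type*} [Fintype n] [DecidableEq n]

/-- **Concl⁰_print-MS IS TRANSLATION COVARIANT IN THE GAUGE** (g0's `N16.conclZd_shiftCfg` with the (1.36)₃ line multi-scale: the word holonomy `hol U₀ y (seg μ j)` is translation covariant for periodic `U₀`, `B12Ineq417Flat.hol_shiftCfg`; original docstring follows).  N16's conclusion slot without the `A`-periodicity clause — `∃ A` self-adjoint with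
`U′ = (e^{iηA})^{u}` relative to `U₀` (`mgauge`), (1.36)₁ `‖A‖ ≤ B(α₀+α₁)`, (1.36)₂ `‖D^η_{U₀,μ}A_κ‖ ≤ B(α₀+α₁)`, (1.38) `IsLandau138 L k η univ
(torusLam k) U₀ A`, the (1.36)₃ Hölder member and (1.39)₁ `‖Δ^η_{U₀}A_κ‖ ≤ B(α₀+α₁)` — passes from `u` to the translate `t_v u`, `v = Lᵏ·a`, for
`v`-periodic `U₀`, `U′`, with the translated field `t_v A` (file 1's covariances). [cite: Balaban1985RegularSpaces, (1.36)–(1.38) p.82, (1.39) p.83, p.77] -/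
theorem conclZdMS_shiftCfg {L k : ℕ} (hL : 1 ≤ L) {η B Bh β α₀ α₁ : ℝ} {U₀ U' : Site d → Fin d → (Matrix n n ℂ)ˣ}
    {u : Site d → (Matrix n n ℂ)ˣ} {a : Site d}
    (hU₀ : shiftCfg (((L : ℤ) ^ k) • a) U₀ = U₀) (hU' : shiftCfg (((L : ℤ) ^ k) • a) U' = U')
    (h : ∃ A : Site d → Fin d → Matrix n n ℂ,
      (∀ x μ, IsSelfAdjoint (A x μ)) ∧ mgauge U₀ u (cfgExp η A) = U' ∧ (∀ x μ, ‖A x μ‖ ≤ B * (α₀ + α₁)) ∧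
      (∀ (μ : Fin d) (x : Site d) (κ : Fin d), ‖covDerivFwd η U₀ μ (fun z => A z κ) x‖ ≤ B * (α₀ + α₁)) ∧
      IsLandau138 L k η Set.univ (torusLam k) U₀ A ∧
      (∀ (κ μ : Fin d) (y : Site d) (j : ℕ), 1 ≤ j → j ≤ L ^ k →
        ‖Ad (hol U₀ y (seg μ (j : ℤ))) (covDerivFwd η U₀ μ (fun z => A z κ) (y + j • e μ)) - covDerivFwd η U₀ μ (fun z => A z κ) y‖
          ≤ Bh * (α₀ + α₁) * ((((L : ℝ)⁻¹) ^ k) ^ β * (j : ℝ) ^ β)) ∧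
      (∀ (x : Site d) (κ : Fin d), ‖covLap η U₀ (fun z => A z κ) x‖ ≤ B * (α₀ + α₁))) :
    ∃ A : Site d → Fin d → Matrix n n ℂ,
      (∀ x μ, IsSelfAdjoint (A x μ)) ∧ mgauge U₀ (shiftCfg (((L : ℤ) ^ k) • a) u) (cfgExp η A) = U' ∧
      (∀ x μ, ‖A x μ‖ ≤ B * (α₀ + α₁)) ∧
      (∀ (μ : Fin d) (x : Site d) (κ : Fin d), ‖covDerivFwd η U₀ μ (fun z => A z κ) x‖ ≤ B * (α₀ + α₁)) ∧
      IsLandau138 L k η Set.univ (torusLam k) U₀ A ∧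
      (∀ (κ μ : Fin d) (y : Site d) (j : ℕ), 1 ≤ j → j ≤ L ^ k →
        ‖Ad (hol U₀ y (seg μ (j : ℤ))) (covDerivFwd η U₀ μ (fun z => A z κ) (y + j • e μ)) - covDerivFwd η U₀ μ (fun z => A z κ) y‖
          ≤ Bh * (α₀ + α₁) * ((((L : ℝ)⁻¹) ^ k) ^ β * (j : ℝ) ^ β)) ∧
      (∀ (x : Site d) (κ : Fin d), ‖covLap η U₀ (fun z => A z κ) x‖ ≤ B * (α₀ + α₁)) := by
  obtain ⟨A, hsa, hmg, hs, hg, h138, hhol, hlap⟩ := h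
  set v : Site d := ((L : ℤ) ^ k) • a with hv
  -- the covariant stencils of the translated field are the translated stencils (`U₀` is `v`-periodic)
  have hD : ∀ (μ κ : Fin d) (x : Site d),
      covDerivFwd η U₀ μ (fun z => shiftCfg v A z κ) x = covDerivFwd η U₀ μ (fun z => A z κ) (x + v) := by
    intro μ κ x
    have e1 : (fun z => shiftCfg v A z κ) = shiftCfg v (fun z => A z κ) := rfl
    rw [e1]
    conv_lhs => rw [← hU₀]
    exact covDerivFwd_shiftCfg η U₀ μ _ v x
  have hΔ : ∀ (κ : Fin d) (x : Site d), covLap η U₀ (fun z => shiftCfg v A z κ) x = covLap η U₀ (fun z => A z κ) (x + v) := by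
    intro κ x
    have e1 : (fun z => shiftCfg v A z κ) = shiftCfg v (fun z => A z κ) := rfl
    rw [e1]
    conv_lhs => rw [← hU₀]
    exact covLap_shiftCfg η U₀ _ v x
  have hU₀v : ∀ (y : Site d) (μ : Fin d), U₀ y μ = U₀ (y + v) μ := fun y μ => by
    have := congr_fun (congr_fun hU₀ y) μ
    rw [shiftCfg_apply] at this
    exact this.symm
  have hHol : ∀ (y : Site d) (w : List (Letter d)), hol U₀ y w = hol U₀ (y + v) w := fun y w => by
    conv_lhs => rw [← hU₀]
    exact hol_shiftCfg v U₀ y w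
  refine ⟨shiftCfg v A, fun x μ => hsa (x + v) μ, ?_, fun x μ => hs (x + v) μ, fun μ x κ => ?_,
    isLandau138_torusLam_shiftCfg hL hU₀ h138, fun κ μ y j hj hjL => ?_, fun x κ => ?_⟩
  · rw [cfgExp_shiftCfg]
    conv_lhs => rw [← hU₀]
    rw [mgauge_shiftCfg, hmg, hU']
  · rw [hD]; exact hg μ (x + v) κ
  · rw [hD, hD, hHol y, add_right_comm y (j • e μ) v]; exact hhol κ μ (y + v) j hj hjL
  · rw [hΔ]; exact hlap (x + v) κ

end Concrete

/-! ## §2 (T4ᵀ_print-MS) at period `N·Lᵏ` from its `ℤᵈ` twin at period `0` -/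

section Print

variable {n : Type*} [Fintype n] [DecidableEq n]

/-- **N16's MULTI-SCALE BINDER FROM ITS `ℤᵈ` TWIN** (g0's `N16.thm4TorusAt_print_of_zd` with the slot's (1.36)₃ line multi-scale; §1 in place of `conclZd_shiftCfg`, g0's `thm4TorusAt_of_period_zero` ∕ `periodic_of_mgauge_cfgExp` BY NAME; original docstring follows).  For every `Reg`, every `k`, `N`, `0 < η ≤ 1`, Thm-4 constants with `0 ≤ B` and `16·B·c₁ ≤ 1`, `L ≥ 1`:
if Theorem 4 holds on the `ℤᵈ` carriers at the all-torus member in N16's letters WITHOUT periodicity — `Thm4TorusAt L k 0 η c₁ unitaryUnits Reg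
(Restr129 L k (torusLam k)) Concl⁰_print` (data on `ℤᵈ`, a gauge on `ℤᵈ`, unique among ALL unitary gauges; the D-0062 desk's `Thm4AllTorus`
reading) — then it holds in the all-torus geometry proper: `Thm4TorusAt L k (N·Lᵏ) η c₁ unitaryUnits Reg (Restr129 L k (torusLam k)) Concl_print`
(periodic data, periodic gauge, periodic `A`, unique among periodic gauges).  §1 with file 1's covariance of (1.29) and §2.
[cite: Balaban1985RegularSpaces, Thm 4 p.88, (1.29) p.81, (1.36)–(1.38) p.82, (1.39) p.83, p.77] -/
theorem thm4TorusAt_printMS_of_zd [Nonempty n] {L : ℕ} (hL : 1 ≤ L) (k N : ℕ) {η c₁ B Bh β : ℝ} (hη : 0 < η) (hη1 : η ≤ 1)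
    (hB : 0 ≤ B) (hBc : 16 * (B * c₁) ≤ 1) (Reg : (Site d → Fin d → (Matrix n n ℂ)ˣ) → Prop)
    (hT : Thm4TorusAt L k 0 η c₁ (unitaryUnits (Matrix n n ℂ)) Reg (Restr129 L k (torusLam k))
      (fun (α₀ α₁ : ℝ) (U₀ U' : Site d → Fin d → (Matrix n n ℂ)ˣ) (u : Site d → (Matrix n n ℂ)ˣ) =>
        ∃ A : Site d → Fin d → Matrix n n ℂ,
          (∀ x μ, IsSelfAdjoint (A x μ)) ∧ mgauge U₀ u (cfgExp η A) = U' ∧ (∀ x μ, ‖A x μ‖ ≤ B * (α₀ + α₁)) ∧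
          (∀ (μ : Fin d) (x : Site d) (κ : Fin d), ‖covDerivFwd η U₀ μ (fun z => A z κ) x‖ ≤ B * (α₀ + α₁)) ∧
          IsLandau138 L k η Set.univ (torusLam k) U₀ A ∧
          (∀ (κ μ : Fin d) (y : Site d) (j : ℕ), 1 ≤ j → j ≤ L ^ k →
            ‖Ad (hol U₀ y (seg μ (j : ℤ))) (covDerivFwd η U₀ μ (fun z => A z κ) (y + j • e μ))
                - covDerivFwd η U₀ μ (fun z => A z κ) y‖
              ≤ Bh * (α₀ + α₁) * ((((L : ℝ)⁻¹) ^ k) ^ β * (j : ℝ) ^ β)) ∧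
          (∀ (x : Site d) (κ : Fin d), ‖covLap η U₀ (fun z => A z κ) x‖ ≤ B * (α₀ + α₁)))) :
    Thm4TorusAt L k (((N * L ^ k : ℕ) : ℤ)) η c₁ (unitaryUnits (Matrix n n ℂ)) Reg (Restr129 L k (torusLam k))
      (fun (α₀ α₁ : ℝ) (U₀ U' : Site d → Fin d → (Matrix n n ℂ)ˣ) (u : Site d → (Matrix n n ℂ)ˣ) =>
        ∃ A : Site d → Fin d → Matrix n n ℂ,
          (∀ x μ, IsSelfAdjoint (A x μ)) ∧ (∀ (x : Site d) (κ μ : Fin d), A (x + (((N * L ^ k : ℕ) : ℤ)) • e κ) μ = A x μ) ∧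
          mgauge U₀ u (cfgExp η A) = U' ∧
          (∀ x μ, ‖A x μ‖ ≤ B * (α₀ + α₁)) ∧
          (∀ (μ : Fin d) (x : Site d) (κ : Fin d), ‖covDerivFwd η U₀ μ (fun z => A z κ) x‖ ≤ B * (α₀ + α₁)) ∧
          IsLandau138 L k η Set.univ (torusLam k) U₀ A ∧
          (∀ (κ μ : Fin d) (y : Site d) (j : ℕ), 1 ≤ j → j ≤ L ^ k →
            ‖Ad (hol U₀ y (seg μ (j : ℤ))) (covDerivFwd η U₀ μ (fun z => A z κ) (y + j • e μ))
                - covDerivFwd η U₀ μ (fun z => A z κ) y‖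
              ≤ Bh * (α₀ + α₁) * ((((L : ℝ)⁻¹) ^ k) ^ β * (j : ℝ) ^ β)) ∧
          (∀ (x : Site d) (κ : Fin d), ‖covLap η U₀ (fun z => A z κ) x‖ ≤ B * (α₀ + α₁))) := by
  -- the period vector is a multiple of `Lᵏ`: `(N·Lᵏ)·e_i = Lᵏ·(N·e_i)`
  have hP : ∀ i : Fin d, (((N * L ^ k : ℕ) : ℤ)) • (e i : Site d) = ((L : ℤ) ^ k) • ((N : ℤ) • e i) := fun i => by
    rw [smul_smul]; push_cast; rw [mul_comm]
  refine thm4TorusAt_of_period_zero hT ?_ ?_ ?_ ?_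
  · intro U₀ u i hU₀ hRes
    rw [hP] at hU₀ ⊢
    exact restr129_torusLam_shiftCfg hU₀ hRes
  · intro α₀ α₁ U₀ U' u i hU₀ hU' hC
    rw [hP] at hU₀ hU' ⊢
    exact conclZdMS_shiftCfg hL hU₀ hU' hC
  · intro α₀ α₁ U₀ U' u hα₀ hα₁ hc hU₀u hU'u huu hU₀P hU'P huP hC
    obtain ⟨A, hsa, hmg, hs, hg, h138, hhol, hlap⟩ := hC
    have hsmall : B * (α₀ + α₁) * η ≤ 1 / 16 := by
      have h1 : B * (α₀ + α₁) ≤ B * c₁ := mul_le_mul_of_nonneg_left hc hB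
      have h2 : 0 ≤ B * (α₀ + α₁) := mul_nonneg hB (by linarith)
      nlinarith
    exact ⟨A, hsa, periodic_of_mgauge_cfgExp hη hsmall hU₀u hU'u huu hU₀P hU'P huP hmg hs, hmg, hs, hg, h138, hhol, hlap⟩
  · rintro α₀ α₁ U₀ U' u ⟨A, hsa, -, hmg, hs, hg, h138, hhol, hlap⟩
    exact ⟨A, hsa, hmg, hs, hg, h138, hhol, hlap⟩

end Print

end

end Summit.QuantumFields.YangMills.BalabanUVNodes.N16HolderMSTorusOfZd
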